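import Summits.Parity.GeneralizedHardyLittlewood.Theses.LeeYangFibres
import Summits.Parity.GeneralizedHardyLittlewood.Theorems.LeeYangFibresAbsoluteUpgradeDipDefs
import Summits.Parity.GeneralizedHardyLittlewood.Theorems.AbsoluteUpgrade.Negative.FibreHyperbolicityAlongLoadBearing
import Summits.Parity.GeneralizedHardyLittlewood.Theorems.AbsoluteUpgrade.Negative.CellParityLawSavingLoadBearing
import Summits.Parity.GeneralizedHardyLittlewood.Theorems.PrimeCellsRelative.Negative.FalseWithoutBoxContainment
import HarnessLib

/-!
# `FibreHyperbolicityAlong` (stmt-Parity-18103): box containment is load-bearing; the hidden rough-tuple content;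
# the physical degree `U(N) = 4` (negative-side support, refuter cdisprove seat, cycle 1)

Sorry-free, unconditional facts about the crux `LeeYangFibres.FibreHyperbolicityAlong` (definitionally the dip line's
`DipMarginRateExchange.FibreHyperbolicityAlong`, whose mass floor, convexity and fugacity positivity were shown
load-bearing in `Theorems/AbsoluteUpgrade/Negative/FibreHyperbolicityAlongLoadBearing`).  This file adds:

* `fibreHyperbolicityAlong_false_without_boxContainment` — the containment `K ⊆ [-N, N]` cannot be dropped: at
  `t = 1`, `L = 1`, `η = 1`, the system `ψ(n) = n` (`𝔖 = 1`) on the far box `K = [2N, 10N]` (convex, `β_∞ = 8N`) has no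
  lattice point of `[-N, N]` inside, all joint cells vanish, the fibre is the zero polynomial and `ζ = I` is a root.
  (Variant stated inline; no proposition is defined under `Summits/`.)
* `fibreHyperbolicityAlong_slice_zero` — the guard `1 ≤ t` is decorative: the `t = 0` body holds vacuously (`Fin 0`
  has no coordinate to free), so the planner may drop the guard without changing the statement.
* `roughTuples_of_fibreHyperbolicityAlong` — the HIDDEN CONTENT of the conclusion shape `fibre ζ = 0 → Im ζ = 0`:
  the crux implies that for `N ≥ N₀(t, L, η)` every admissible body of mass `≥ ηN` contains a lattice point at which
  all `t` forms are `N^{1/U(N)}`-rough with `1 ≤ Ω ≤ U(N)`; by `slowDegree_eq_four_of_le` (`U(N) = 4` for all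
  `N ≤ 2^78`) this is, at every physical `N`, a `t`-dimensional sieve existence assertion at sieve parameter `s = 4`,
  below the sieving limit `β_t` of the known `t`-dimensional sieves for `t ≥ 2` — harmless for the truth of the crux
  (`N₀` may be astronomically large), but part of what any proof effective from a physical `N₀` must deliver.
* `slowDegree_eq_four_of_log`, `slowDegree_eq_four_of_le`, `fibre_slowDegree_eq_fibre_four` — the schedule
  `U(N) = max 4 ⌊√(log log N)/2⌋` equals `4` whenever `log log N < 4`, in particular for `N ≤ 2^78`; there the crux's
  fibre IS the fixed-degree crux's fibre at `u = 4` (`ζ·(cubic)`; one discriminant per fibre when the values of the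
  free form stay `≤ N`).
[folklore]
-/

noncomputable section

namespace Summit.Parity.GeneralizedHardyLittlewood.Theorems.FibreHyperbolicityAlong.Negative

open scoped BigOperators Classical
open MeasureTheory Literature.NumberTheory.Sieve
open Summit.Parity.GeneralizedHardyLittlewood.Theses.LeeYangFibres (FibreHyperbolicityAlong)
open Summit.Parity.GeneralizedHardyLittlewood.Cruxes.FibreHyperbolicity.ModelTransfer (jointCell fibre)
open Summit.Parity.GeneralizedHardyLittlewood.Cruxes.AbsoluteUpgrade.DipMarginRateExchange
  (slowDegree four_le_slowDegree)
open Summit.Parity.GeneralizedHardyLittlewood.Theorems.AbsoluteUpgrade.Negative.FibreAlong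
  (fibre_eq_zero_of_forall_not_mem exists_jointCell_ne_zero_of_fibreShape isNondegenerateSystem_id affLinSize_id)
open Summit.Parity.GeneralizedHardyLittlewood.Theorems.AbsoluteUpgrade.Negative.CellSaving (realPoint_not_mem_farBox)
open Summit.Parity.GeneralizedHardyLittlewood.Theorems.PrimeCellsRelative.Negative.BoxContainment
  (archFactor_id_farBox singularProduct_id)

/-! ### Box containment is load-bearing -/

/-- **Box containment `K ⊆ [-N, N]` cannot be dropped from `FibreHyperbolicityAlong`.**  Witness at `t = 1`,
`L = 1`, `η = 1`: `ψ(n) = n`, `K = [2N, 10N]` (`β_∞ 𝔖 = 8N ≥ N`), zero fibre, root `I`. [folklore] -/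
theorem fibreHyperbolicityAlong_false_without_boxContainment :
    ¬ (∀ (t L : ℕ), 1 ≤ t → ∀ η : ℝ, 0 < η → ∃ N₀ : ℕ, ∀ N : ℕ, N₀ ≤ N →
        ∀ Ψ : Fin t → AffLinForm 1, IsNondegenerateSystem Ψ → affLinSize Ψ N ≤ L →
        ∀ K : Set (Fin 1 → ℝ), Convex ℝ K →
        η * (N : ℝ) ≤ archFactor Ψ K * singularProduct Ψ →
        ∀ i : Fin t, ∀ w : Fin t → ℝ, (∀ k, 0 < w k ∧ w k ≤ 1) →
        ∀ ζ : ℂ, fibre t N (slowDegree N) Ψ K i w ζ = 0 → ζ.im = 0) := by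
  intro h
  obtain ⟨N₀, hN₀⟩ := h 1 1 le_rfl 1 one_pos
  have h1 : 1 ≤ max N₀ 1 := le_max_right _ _
  have hb := hN₀ (max N₀ 1) (le_max_left _ _) (fun _ => ⟨fun _ => 1, 0⟩) isNondegenerateSystem_id
    (affLinSize_id _) (Set.Icc (fun _ : Fin 1 => (2 * (max N₀ 1 : ℕ) : ℝ)) (fun _ => 10 * (max N₀ 1 : ℕ)))
    (convex_Icc _ _) ?_ 0 (fun _ => 1) (fun _ => ⟨one_pos, le_rfl⟩) Complex.I
    (fibre_eq_zero_of_forall_not_mem _ (fun n hn => realPoint_not_mem_farBox h1 hn) _ _ _)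
  · simp at hb
  · rw [archFactor_id_farBox, singularProduct_id]
    push_cast
    have : (1 : ℝ) ≤ max (N₀ : ℝ) 1 := le_max_right _ _
    nlinarith

/-! ### The guard `1 ≤ t` is decorative -/

/-- At `t = 0` the body of `FibreHyperbolicityAlong` holds for every `L, η, N`: there is no coordinate `i : Fin 0`.
So `1 ≤ t` can be dropped from the statement without changing it. [folklore] -/
theorem fibreHyperbolicityAlong_slice_zero (L : ℕ) (η : ℝ) (N : ℕ) :
    ∀ Ψ : Fin 0 → AffLinForm 1, IsNondegenerateSystem Ψ → affLinSize Ψ N ≤ L →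
    ∀ K : Set (Fin 1 → ℝ), Convex ℝ K → K ⊆ realBox 1 N →
    η * (N : ℝ) ≤ archFactor Ψ K * singularProduct Ψ →
    ∀ i : Fin 0, ∀ w : Fin 0 → ℝ, (∀ k, 0 < w k ∧ w k ≤ 1) →
    ∀ ζ : ℂ, fibre 0 N (slowDegree N) Ψ K i w ζ = 0 → ζ.im = 0 :=
  fun _ _ _ _ _ _ _ i => i.elim0

/-! ### Hidden content: rough `t`-tuples in every admissible body -/

/-- **`FibreHyperbolicityAlong` contains a sieve existence statement.**  For `N ≥ N₀(t, L, η)`, every admissible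
`(Ψ, K)` of mass `≥ ηN` has a lattice point `n ∈ K ∩ [-N, N]` with every `ψ_k(n)` `N^{1/U(N)}`-rough and
`1 ≤ Ω(ψ_k(n)) ≤ U(N)` (the fibre at `w = (1,…,1)` must be a non-zero polynomial, else `ζ = I` is a root). [folklore] -/
theorem roughTuples_of_fibreHyperbolicityAlong (h : FibreHyperbolicityAlong) :
    ∀ (t L : ℕ), 1 ≤ t → ∀ η : ℝ, 0 < η → ∃ N₀ : ℕ, ∀ N : ℕ, N₀ ≤ N →
      ∀ Ψ : Fin t → AffLinForm 1, IsNondegenerateSystem Ψ → affLinSize Ψ N ≤ L →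
      ∀ K : Set (Fin 1 → ℝ), Convex ℝ K → K ⊆ realBox 1 N →
      η * (N : ℝ) ≤ archFactor Ψ K * singularProduct Ψ →
      ∃ n ∈ latticeBox 1 N, realPoint n ∈ K ∧ ∀ k,
        (N : ℝ) ^ ((1 : ℝ) / (slowDegree N : ℕ)) < (Nat.minFac ((Ψ k).eval n).toNat : ℝ) ∧
        1 ≤ ArithmeticFunction.cardFactors ((Ψ k).eval n).toNat ∧
        ArithmeticFunction.cardFactors ((Ψ k).eval n).toNat ≤ slowDegree N := by
  intro t L ht η hη
  obtain ⟨N₀, hN₀⟩ := h t L ht η hη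
  refine ⟨N₀, fun N hN Ψ hΨ hL K hK hKN hmass => ?_⟩
  have hfib := hN₀ N hN Ψ hΨ hL K hK hKN hmass ⟨0, ht⟩ (fun _ => 1) (fun _ => ⟨one_pos, le_rfl⟩)
  obtain ⟨j, hj, hne⟩ := exists_jointCell_ne_zero_of_fibreShape hfib
  obtain ⟨n, hn⟩ := Finset.card_ne_zero.mp hne
  rw [Finset.mem_filter] at hn
  refine ⟨n, hn.1, hn.2.1, fun k => ⟨(hn.2.2 k).1, ?_, ?_⟩⟩
  · rw [(hn.2.2 k).2]
    exact (Finset.mem_Icc.mp (Fintype.mem_piFinset.mp hj k)).1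
  · rw [(hn.2.2 k).2]
    exact (Finset.mem_Icc.mp (Fintype.mem_piFinset.mp hj k)).2

/-! ### The physical degree: `U(N) = 4` whenever `log log N < 4` -/

/-- `U(N) = 4` as soon as `log log N < 4`. [folklore] -/
theorem slowDegree_eq_four_of_log {N : ℕ} (hN : Real.log (Real.log N) < 4) : slowDegree N = 4 := by
  unfold slowDegree
  have hs : Real.sqrt (Real.log (Real.log N)) < 2 := by
    rw [Real.sqrt_lt' two_pos]
    linarith
  have hfloor : ⌊Real.sqrt (Real.log (Real.log N)) / 2⌋₊ = 0 := by
    rw [Nat.floor_eq_zero]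
    linarith
  rw [hfloor]
  rfl

/-- `U(N) = 4` for every `N ≤ 2^78 ≈ 3·10²³` (`log N ≤ 78 log 2 < 54.1 < e^4`). [folklore] -/
theorem slowDegree_eq_four_of_le {N : ℕ} (hN : N ≤ 2 ^ 78) : slowDegree N = 4 := by
  apply slowDegree_eq_four_of_log
  have hlog2 := Real.log_two_lt_d9
  have he : (54.1 : ℝ) < Real.exp 4 := by
    have h1 := Real.exp_one_gt_d9
    have : Real.exp 4 = Real.exp 1 ^ 4 := by rw [← Real.exp_nat_mul]; norm_num
    rw [this]
    have h2 : (2.7182818283 : ℝ) ^ 4 ≤ Real.exp 1 ^ 4 := pow_le_pow_left₀ (by norm_num) h1.le 4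
    have h3 : (54.1 : ℝ) < (2.7182818283 : ℝ) ^ 4 := by norm_num
    exact h3.trans_le h2
  have hlogN : Real.log N < Real.exp 4 := by
    rcases Nat.eq_zero_or_pos N with rfl | hpos
    · simp; positivity
    · have : Real.log N ≤ Real.log ((2 : ℝ) ^ 78) := by
        apply Real.log_le_log (by exact_mod_cast hpos)
        exact_mod_cast hN
      rw [Real.log_pow] at this
      push_cast at this
      linarith
  rcases le_or_gt (Real.log N) 0 with hle | hpos
  · have h0 : Real.log N = 0 := le_antisymm hle (Real.log_natCast_nonneg N)
    rw [h0, Real.log_zero]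
    norm_num
  · calc Real.log (Real.log N) < Real.log (Real.exp 4) := Real.log_lt_log hpos hlogN
      _ = 4 := Real.log_exp 4

/-- For `N ≤ 2^78` the fibre of `FibreHyperbolicityAlong` is the fixed-degree fibre at `u = 4`. [folklore] -/
theorem fibre_slowDegree_eq_fibre_four {N : ℕ} (hN : N ≤ 2 ^ 78) (t : ℕ) (Ψ : Fin t → AffLinForm 1)
    (K : Set (Fin 1 → ℝ)) (i : Fin t) (w : Fin t → ℝ) (ζ : ℂ) :
    fibre t N (slowDegree N) Ψ K i w ζ = fibre t N 4 Ψ K i w ζ := by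
  rw [slowDegree_eq_four_of_le hN]

end Summit.Parity.GeneralizedHardyLittlewood.Theorems.FibreHyperbolicityAlong.Negative

end
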